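import Literature.NumberTheory.PAdicHodge.FontaineOmega
import HarnessLib

/-!
# Divisibility in the tilt `𝒪_{ℂ_F}♭` from norms of untilts; `(ε − 1)♯ ≠ 0`

Topic `Literature/NumberTheory/PAdicHodge`; namespace `Literature.NumberTheory.PAdicHodge`. THEOREMS ONLY (no definition, no named
fact, no instance). The tilt `𝒪_{ℂ_F}♭` (Mathlib `PreTilt (integerC F) p`) is a valuation ring for `x ↦ ‖x♯‖`; this file records the
divisibility consequences needed by Fontaine's `𝔸_inf`-lemma (sequel `AinfThetaFrobeniusKernel`), generalising the construction
`divPFlat` (division by `p♭`) of `FontaineThetaKernel`: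

* ★ `exists_eq_mul_of_norm_untilt_le` — **if `‖b♯‖ ≤ ‖a♯‖` and `a♯ ≠ 0` then `a ∣ b` in `𝒪_{ℂ_F}♭`** (the quotient is the compatible
  system `(φ^{-n}b)♯/(φ^{-n}a)♯ ∈ 𝒪_{ℂ_F}`);
* `untilt_ne_zero` — **`x ≠ 0 ⇒ x♯ ≠ 0`** (all coefficients of `x` are the reductions of the `(φ^{-n}x)♯`);
* `eps_sub_one_ne_zero`, `untilt_eps_sub_one_ne_zero`, `norm_untilt_eps_sub_one_lt_one` — **`ε ≠ 1`** (its coefficient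
  `ζ_{p²} mod p` is not `1`, as `‖ζ_{p²} − 1‖^{p(p−1)} = ‖p‖`), hence `(ε − 1)♯ ≠ 0`, and `‖(ε−1)♯‖ < 1`.

Input of the `t`-divisibility statement (TDIV) of the φ-road of line `kato_lever` (crux K★ `stmt-BirchSwinnertonDyer-22226`, memo
`Cruxes/StarredOptimalManinUnitFiveSeven/Lines/kato-lever-K2-fontaine-lemma.md` §1). Infrastructure only: BSD / K★ are not proved by this.

## References
* [FontaineAsterisque223III] J.-M. Fontaine, *Le corps des périodes p-adiques*, Astérisque 223 (1994), Exp. II §1.2.2 (`R = 𝒪_{ℂ}♭` is a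
  valuation ring with `v_R(x) = v(x^{(0)})`).
* [FontaineOuyang2022] J.-M. Fontaine, Y. Ouyang, *Theory of p-adic Galois representations*, Prop. 4.3.3.
-/

noncomputable section

open ValuativeRel Field Ideal WittVector UniformSpace

namespace Literature.NumberTheory.PAdicHodge

open Literature.NumberTheory.GaloisRepresentations
open Literature.NumberTheory.GaloisRepresentations.IsNonarchimedeanLocalField

variable {F : Type} [Field F] [ValuativeRel F] [TopologicalSpace F] [IsNonarchimedeanLocalField F]
  [CharZero F] {p : ℕ} [Fact p.Prime] [Fact (¬ IsUnit (p : integerC F))]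
  [IsAdicComplete (Ideal.span {(p : integerC F)}) (integerC F)]

/-! ### `x ≠ 0 ⇒ x♯ ≠ 0` -/

omit [CharZero F] in
/-- **`x♯ = 0 ⇒ x = 0` in `𝒪_{ℂ_F}♭`**: every coefficient `x_n = (φ^{-n}x)♯ mod p` vanishes because `((φ^{-n}x)♯)^{pⁿ} = x♯ = 0` and
`𝒪_{ℂ_F}` is a domain. [cite: FontaineAsterisque223III, Exp. II §1.2.2] -/
theorem untilt_ne_zero {x : PreTilt (integerC F) p} (hx : x ≠ 0) : PreTilt.untilt x ≠ 0 := by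
  intro h
  refine hx (Perfection.ext fun n => ?_)
  change PreTilt.coeff n x = PreTilt.coeff n (0 : PreTilt (integerC F) p)
  rw [map_zero, ← mk_untilt_frobeniusEquiv_symm x n, Ideal.Quotient.eq_zero_iff_mem]
  have h1 : PreTilt.untilt (((frobeniusEquiv (PreTilt (integerC F) p) p).symm^[n]) x) ^ p ^ n = 0 := by
    rw [PreTilt.untilt_iterate_frobeniusEquiv_symm_pow, h]
  rw [pow_eq_zero_iff (pow_ne_zero n (Fact.out : p.Prime).ne_zero)] at h1
  rw [h1]; exact Submodule.zero_mem _

/-! ### Divisibility from norms of untilts -/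

omit [CharZero F] in
/-- The norms of the `pⁿ`-th roots compare like the norms: `‖(φ^{-n}b)♯‖ ≤ ‖(φ^{-n}a)♯‖` if `‖b♯‖ ≤ ‖a♯‖`. [folklore] -/
private theorem norm_untilt_symm_iterate_le {a b : PreTilt (integerC F) p}
    (hle : ‖((PreTilt.untilt b : integerC F) : CompletedAlgClosure F)‖ ≤ ‖((PreTilt.untilt a : integerC F) : CompletedAlgClosure F)‖)
    (n : ℕ) :
    ‖((PreTilt.untilt (((frobeniusEquiv (PreTilt (integerC F) p) p).symm^[n]) b) : integerC F) : CompletedAlgClosure F)‖ ≤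
      ‖((PreTilt.untilt (((frobeniusEquiv (PreTilt (integerC F) p) p).symm^[n]) a) : integerC F) : CompletedAlgClosure F)‖ := by
  refine le_of_pow_le_pow_left₀ (pow_ne_zero n (Fact.out : p.Prime).ne_zero) (norm_nonneg _) ?_
  rw [norm_untilt_frobeniusEquiv_symm_pow, norm_untilt_frobeniusEquiv_symm_pow]
  exact hle

omit [CharZero F] in
/-- `(φ^{-n}a)♯ ≠ 0` in `ℂ_F` when `a♯ ≠ 0`. [folklore] -/
private theorem coe_untilt_symm_iterate_ne_zero {a : PreTilt (integerC F) p}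
    (ha : ((PreTilt.untilt a : integerC F) : CompletedAlgClosure F) ≠ 0) (n : ℕ) :
    ((PreTilt.untilt (((frobeniusEquiv (PreTilt (integerC F) p) p).symm^[n]) a) : integerC F) : CompletedAlgClosure F) ≠ 0 := by
  intro h
  apply ha
  rw [← PreTilt.untilt_iterate_frobeniusEquiv_symm_pow a n, SubmonoidClass.coe_pow, h, zero_pow (pow_ne_zero n (Fact.out : p.Prime).ne_zero)]

omit [CharZero F] in
/-- The compatible quotients `(φ^{-n}b)♯ / (φ^{-n}a)♯ ∈ 𝒪_{ℂ_F}`. [folklore] -/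
private theorem norm_untilt_div_untilt_le_one {a b : PreTilt (integerC F) p}
    (ha : ((PreTilt.untilt a : integerC F) : CompletedAlgClosure F) ≠ 0)
    (hle : ‖((PreTilt.untilt b : integerC F) : CompletedAlgClosure F)‖ ≤ ‖((PreTilt.untilt a : integerC F) : CompletedAlgClosure F)‖)
    (n : ℕ) :
    ‖((PreTilt.untilt (((frobeniusEquiv (PreTilt (integerC F) p) p).symm^[n]) b) : integerC F) : CompletedAlgClosure F) /
        ((PreTilt.untilt (((frobeniusEquiv (PreTilt (integerC F) p) p).symm^[n]) a) : integerC F) : CompletedAlgClosure F)‖ ≤ 1 := by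
  rw [norm_div, div_le_one (norm_pos_iff.2 (coe_untilt_symm_iterate_ne_zero ha n))]
  exact norm_untilt_symm_iterate_le hle n

omit [CharZero F] in
/-- ★ **Divisibility in `𝒪_{ℂ_F}♭` from norms: if `a♯ ≠ 0` and `‖b♯‖ ≤ ‖a♯‖` then `a ∣ b`** — the quotient `b/a` is the element with
coefficients `((φ^{-n}b)♯/(φ^{-n}a)♯) mod p` (`𝒪_{ℂ_F}♭` is a valuation ring for `v(x) = ‖x♯‖`).
[cite: FontaineAsterisque223III, Exp. II §1.2.2] [cite: FontaineOuyang2022, Prop. 4.3.3] -/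
theorem exists_eq_mul_of_norm_untilt_le {a b : PreTilt (integerC F) p}
    (ha : ((PreTilt.untilt a : integerC F) : CompletedAlgClosure F) ≠ 0)
    (hle : ‖((PreTilt.untilt b : integerC F) : CompletedAlgClosure F)‖ ≤ ‖((PreTilt.untilt a : integerC F) : CompletedAlgClosure F)‖) :
    ∃ c : PreTilt (integerC F) p, b = a * c := by
  -- the quotient sequence in `𝒪_{ℂ_F}`
  let q : ℕ → integerC F := fun n =>
    ⟨((PreTilt.untilt (((frobeniusEquiv (PreTilt (integerC F) p) p).symm^[n]) b) : integerC F) : CompletedAlgClosure F) /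
        ((PreTilt.untilt (((frobeniusEquiv (PreTilt (integerC F) p) p).symm^[n]) a) : integerC F) : CompletedAlgClosure F),
      (mem_integerC_iff).2 (norm_untilt_div_untilt_le_one ha hle n)⟩
  have hq_mul : ∀ n, PreTilt.untilt (((frobeniusEquiv (PreTilt (integerC F) p) p).symm^[n]) a) * q n =
      PreTilt.untilt (((frobeniusEquiv (PreTilt (integerC F) p) p).symm^[n]) b) := fun n =>
    Subtype.ext (by
      change ((PreTilt.untilt _ : integerC F) : CompletedAlgClosure F) * (_ / _) = _
      rw [mul_div_cancel₀ _ (coe_untilt_symm_iterate_ne_zero ha n)])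
  have hq_pow : ∀ n, q (n + 1) ^ p = q n := fun n =>
    Subtype.ext (by
      change (((PreTilt.untilt _ : integerC F) : CompletedAlgClosure F) / _) ^ p = ((PreTilt.untilt _ : integerC F) : CompletedAlgClosure F) / _
      rw [div_pow, ← SubmonoidClass.coe_pow, ← SubmonoidClass.coe_pow, untilt_frobeniusEquiv_symm_succ_pow,
        untilt_frobeniusEquiv_symm_succ_pow])
  refine ⟨⟨fun n => Ideal.Quotient.mk _ (q n), fun n => by rw [← map_pow, hq_pow]⟩, Perfection.ext fun n => ?_⟩
  change PreTilt.coeff n b = PreTilt.coeff n (a * _)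
  rw [map_mul, ← mk_untilt_frobeniusEquiv_symm b n, ← mk_untilt_frobeniusEquiv_symm a n, ← hq_mul n, map_mul]
  rfl

omit [CharZero F] in
/-- **Units of `𝒪_{ℂ_F}♭`**: if `‖a♯‖ = 1` then `a` is a unit. [cite: FontaineAsterisque223III, Exp. II §1.2.2] -/
theorem isUnit_of_norm_untilt_eq_one {a : PreTilt (integerC F) p}
    (ha : ‖((PreTilt.untilt a : integerC F) : CompletedAlgClosure F)‖ = 1) : IsUnit a := by
  have ha0 : ((PreTilt.untilt a : integerC F) : CompletedAlgClosure F) ≠ 0 := fun h => by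
    rw [h, norm_zero] at ha; exact zero_ne_one ha
  obtain ⟨c, hc⟩ := exists_eq_mul_of_norm_untilt_le (b := 1) ha0 (by rw [map_one, OneMemClass.coe_one, norm_one, ha])
  exact IsUnit.of_mul_eq_one c hc.symm

/-! ### `ε ≠ 1`, `(ε − 1)♯ ≠ 0`, `‖(ε − 1)♯‖ < 1` -/

omit [IsAdicComplete (Ideal.span {(p : integerC F)}) (integerC F)] in
/-- **`ε − 1 ≠ 0` in `𝒪_{ℂ_F}♭`**: its coefficient `ζ_{p²} − 1 mod p` is nonzero since `‖ζ_{p²} − 1‖ > ‖p‖`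
(`‖ζ_{p²} − 1‖^{p(p−1)} = ‖p‖ < 1`). [cite: FontaineAsterisque223III, Exp. II §1.5.4] -/
theorem eps_sub_one_ne_zero : (eps : PreTilt (integerC F) p) - 1 ≠ 0 := by
  have hp := (Fact.out : p.Prime)
  intro h
  have h1 : PreTilt.coeff 2 ((eps : PreTilt (integerC F) p) - 1) = 0 := by rw [h, map_zero]
  rw [map_sub, map_one, coeff_eps, ← map_one (Ideal.Quotient.mk (Ideal.span {(p : integerC F)})), ← map_sub,
    Ideal.Quotient.eq_zero_iff_mem] at h1
  have hp0 : (p : CompletedAlgClosure F) ≠ 0 := natCast_C_ne_zero hp.ne_zero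
  have hp0' : ((p : integerC F) : CompletedAlgClosure F) ≠ 0 := by rw [coe_natCast_integerC]; exact hp0
  rw [← pow_one (Ideal.span {(p : integerC F)}), mem_span_pow_iff hp0' 1, pow_one, coe_natCast_integerC, AddSubgroupClass.coe_sub,
    OneMemClass.coe_one] at h1
  -- `‖ζ_{p²} − 1‖^{p(p-1)} = ‖p‖`
  have h2 := norm_epsC_sub_one_pow (F := F) (p := p) (m := 2) (by norm_num)
  rw [Nat.totient_prime_pow hp (by norm_num : 0 < 2), show 2 - 1 = 1 from rfl, pow_one] at h2
  have hlt : ‖(p : CompletedAlgClosure F)‖ < 1 := norm_natCast_C_lt_one'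
  have hk : 2 ≤ p * (p - 1) := by
    have h2le : 2 ≤ p := hp.two_le
    calc 2 = 2 * 1 := by norm_num
      _ ≤ p * (p - 1) := Nat.mul_le_mul h2le (by omega)
  -- `‖p‖ = ‖ζ−1‖^{k} ≤ ‖p‖^k < ‖p‖`
  have h3 : ‖(p : CompletedAlgClosure F)‖ ≤ ‖(p : CompletedAlgClosure F)‖ ^ (p * (p - 1)) := by
    conv_lhs => rw [← h2]
    exact pow_le_pow_left₀ (norm_nonneg _) h1 _
  have h4 : ‖(p : CompletedAlgClosure F)‖ ^ (p * (p - 1)) < ‖(p : CompletedAlgClosure F)‖ ^ 1 :=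
    pow_lt_pow_right_of_lt_one₀ (norm_pos_iff.2 hp0) hlt (by omega)
  rw [pow_one] at h4
  exact absurd (h3.trans_lt h4) (lt_irrefl _)

/-- **`(ε − 1)♯ ≠ 0`** in `𝒪_{ℂ_F}`. [cite: FontaineAsterisque223III, Exp. II §1.5.4] -/
theorem untilt_eps_sub_one_ne_zero : PreTilt.untilt ((eps : PreTilt (integerC F) p) - 1) ≠ 0 :=
  untilt_ne_zero eps_sub_one_ne_zero

/-- **`(ε − 1)♯ ≠ 0` in `ℂ_F`.** [cite: FontaineAsterisque223III, Exp. II §1.5.4] -/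
theorem coe_untilt_eps_sub_one_ne_zero :
    ((PreTilt.untilt ((eps : PreTilt (integerC F) p) - 1) : integerC F) : CompletedAlgClosure F) ≠ 0 := fun h =>
  untilt_eps_sub_one_ne_zero (Subtype.ext h)

/-- **`‖(ε − 1)♯‖ < 1`**: `(ε − 1)♯ ≡ θ([ε] − 1) = 0 (mod p)`, i.e. `(ε−1)♯ ∈ p𝒪_{ℂ_F}` (its reduction mod `p` is the `0`-th coefficient
`ζ_1 − 1 = 0` of `ε − 1`). [cite: FontaineAsterisque223III, Exp. II §1.5.4] -/
theorem norm_untilt_eps_sub_one_lt_one :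
    ‖((PreTilt.untilt ((eps : PreTilt (integerC F) p) - 1) : integerC F) : CompletedAlgClosure F)‖ < 1 := by
  have h0 : PreTilt.coeff 0 ((eps : PreTilt (integerC F) p) - 1) = 0 := by
    rw [map_sub, map_one, coeff_eps, sub_eq_zero]
    have : (epsC p 0 : integerC F) = 1 := by
      have h := epsC_pow (F := F) (p := p) 0
      rwa [pow_zero, pow_one] at h
    rw [this, map_one]
  exact (norm_untilt_le_of_coeff_zero_eq_zero h0).trans_lt norm_natCast_C_lt_one'

end Literature.NumberTheory.PAdicHodge

end
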